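import Literature.RepresentationTheory.CompactGroups.SimpleCompactGroupFiniteCentre
import Literature.MathematicalPhysics.QuantumFieldTheory.YangMillsOS
import HarnessLib

/-!
# Every compact simple Lie group of the tree (`IsCompactSimpleLieGroup`) has FINITE CENTRE — the L-type stub `CentreFinite` of line
# «meso-vortex-growth» (crux `IRcof`, stmt-QuantumFields-26930, census sub-row 21c) DISCHARGED by name-compatible statement

Helper for crux `IRcof` (stmt-QuantumFields-26930).  Ideator ym-ir-idea-23 g0's LINE 1′ rev 6 (`Cruxes/IRcof/Lines/meso_vortex_growth.lean`)
registers the support stub `stub_centreFinite : CentreFinite` with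
`CentreFinite := ∀ (G : Type) [Group G] [TopologicalSpace G] [CompactSpace G], IsCompactSimpleLieGroup G → Finite (Subgroup.center G)`
(Bröcker–tom Dieck V (7.13): a compact simple Lie group has finite centre).  This file proves exactly that body (`centreFinite`), so the stub closes by
`exact centreFinite` once the Lines module imports this file.  Proof: `IsCompactSimpleLieGroup G = IsSimpleCompactGroup G ∧ Nonempty (LatticeRep G)`;
a `LatticeRep` is a faithful continuous unitary matrix representation (`IsFaithfulUnitaryRep`), and the Literature theorem
`IsFaithfulUnitaryRep.finite_center_of_simple` (`Literature/RepresentationTheory/CompactGroups/SimpleCompactGroupFiniteCentre.lean`: simple ⇒ the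
closed unitary matrix group `range ρ` is semisimple ⇒ finite centre, V (3.14), lane lit-balaban's `MatrixLie.isSemisimpleGroup_iff_finite_center`)
applies verbatim.  Custody LEAD ym-ir-line-ab-p1 g7 (the census desk g8 left the filing of «Z(G) finite» to the LEAD, v6.82).

HONEST FRAMING: a classical Lie-group fact (width 0 toward PXcof ∕ N_cof); nothing here proves `IRcof`, `IR`, or the Clay Yang–Mills mass gap
(NOT proved anywhere in this tree; R4 = the conditional finite-𝕋⁴ rung `BalabanLadder.UV` only).
-/

noncomputable section

open Literature.MathematicalPhysics.QuantumFieldTheory Literature.MathematicalPhysics.QuantumLattice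
open Literature.RepresentationTheory.CompactGroups

namespace Summit.QuantumFields.YangMills.Cruxes.IRcof.CentreFinite

/-- A `LatticeRep` is a faithful continuous unitary matrix representation in the sense of `IsFaithfulUnitaryRep`. -/
theorem isFaithfulUnitaryRep_latticeRep {G : Type} [Group G] [TopologicalSpace G] (r : LatticeRep G) :
    IsFaithfulUnitaryRep r.ρ :=
  ⟨r.continuous, r.injective, r.mem_unitary⟩

/-- **`CentreFinite` (PROVED): every compact simple Lie group of the tree has finite centre.**  Verbatim the body of idea-23's stub
`stub_centreFinite` (line «meso-vortex-growth», stmt-QuantumFields-26930): for every compact group `G` with `IsCompactSimpleLieGroup G`,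
`Subgroup.center G` is `Finite`.  [Bröcker–tom Dieck, GTM 98, V (7.13) with V (3.14).] -/
theorem centreFinite : ∀ (G : Type) [Group G] [TopologicalSpace G] [CompactSpace G],
    IsCompactSimpleLieGroup G → Finite (Subgroup.center G) := by
  intro G _ _ _ hG
  obtain ⟨⟨hconn, hna, hsimple⟩, ⟨r⟩⟩ := hG
  haveI : ConnectedSpace G := hconn
  exact (isFaithfulUnitaryRep_latticeRep r).finite_center_of_simple hna hsimple

/-- Pointwise form: `IsCompactSimpleLieGroup G → Finite (Subgroup.center G)`. -/
theorem finite_center_of_isCompactSimpleLieGroup {G : Type} [Group G] [TopologicalSpace G] [CompactSpace G]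
    (hG : IsCompactSimpleLieGroup G) : Finite (Subgroup.center G) :=
  centreFinite G hG

end Summit.QuantumFields.YangMills.Cruxes.IRcof.CentreFinite

end
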